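import Summits.QuantumFields.YangMills.Theorems.FluctuationComparisonRegPrIntLS2BetaChartReadSecondOrder
import HarnessLib

/-!
# S2β · AVG₂♭-ax_q route, step (5a) — THE TWO-BLOCK `ℓ¹` COUNT OF THE ORDER-2 ONE-STEP BRICK:
# `Σ_c ‖ψ_{U₀}(X)(c) − (Dψ_{U₀}(0) X)(c)‖ ≤ 4550400·2d·((d+2)L)²·Σ_b ‖X b‖²` for EVERY chart direction `X` (no radius condition)

Cell `ym3-torus` (YM ladder rung R3 = continuum `SU(2)` Yang–Mills on the three-torus at fixed lattice data — a RUNG: NOT d = 4, NOT infinite volume,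
NOT a mass gap, NOT Clay).  Width seat «width 20» `ym3-torus-px20` (gen 23), FREE px helper on crux `stmt-QuantumFields-20520`
(`…Theses.UnitScaleTilt.FluctuationComparisonRegPrIntL`), LINE g18-1 S2β, pairing lane «CRIT-ax» ⟸ «MULT♭-ax» ⟸ ✓`multAx_of_letters` ⟸ {Thm-1 pair,
(RINV-curl)_q ✓p827199, AVG₂♭-ax_q}; AVG₂♭-ax_q's route (UV3-NODE §89.7) step (5) «the two counts», smooth-purse half, ONE STEP (px10 g24 «GO (b)» 15:50:23Z).
`--kind proof --supports stmt-QuantumFields-20520 --as helper`, count-neutral, DEFINITION-FREE (0 `def`, 0 `instance`, 0 `notation`, 0 `sorry`), default heartbeats.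

WHY.  px13 g26's (β-3) ✓`…S2BetaChartReadSecondOrder` gives [Balaban1985Averaging] Prop. 3 (123) for the tree's chart-read one-step (0.4) EML average in SUP currency:
`‖↑(ψ_{U₀}(X) c) − ↑((Dψ_{U₀}(0) X) c)‖ ≤ 4550400·ℓ²·‖X‖²` for EVERY `X` (`SU(2)`, loop guard `α ≤ 1∕12`, `ℓ = (d+2)L`; `norm_chartRead_sub_fderiv_le_global_SU2`).  The letter
AVG₂♭-ax_q (✓p825995's `hM`) is stated in `ℓ¹` over COARSE bonds against `ℓ²`-type sums over FINE bonds (`N⁻¹·Σ_ℓ dist1² + N·Σ_p (1 − reTr)`), uniformly in the volume.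
This file converts the brick into that currency at one step, by two facts about the tree's own lattice: the one-step average at `c` reads only the bonds issuing from
`B(c₋) ∪ B(c₊)` ((β-3) v1.3 §6, the LOCAL edition with no radius condition, over ✓`chartRead_apply_local` ∕ ✓`fderiv_chartRead_apply_local`), and every fine block is `c₋`
for `d` coarse bonds and `c₊` for `d` coarse bonds.

WHAT IS PROVED (sorry-free; standing range `j + 1 ≤ m + K` where locality is used).
* §1 `card_filter_src_or_tgt_le` — `#{c : PBond P (j+1) ∣ y = c₋ ∨ y = c₊} ≤ 2d`; ★`sum_sum_twoBlock_le` — for `g ≥ 0`: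
  `Σ_c Σ_{b : blockOf b₋ ∈ {c₋, c₊}} g b ≤ 2d·Σ_b g b` (Fubini over the incidence, then the count).
* §2 `norm_truncate_le_sqrt_sum`, ★`norm_truncate_sq_le_sum` — for the sup norm of a finite product: `‖X·𝟙_S‖² ≤ Σ_{b ∈ S} ‖X b‖²`.
* §3 ★★★`sum_norm_chartRead_sub_fderiv_le_SU2` (over (β-3) v1.3 §6 ✓`norm_chartRead_sub_fderiv_le_local_SU2`, the LOCAL edition with NO radius condition:
  `≤ 4550400·ℓ²·‖X^{(c)}‖²`, `X^{(c)} := X·𝟙{blockOf b₋ ∈ {c₋, c₊}}` — px13 g26 «MINE §6» 16:10:59Z) — **`Σ_c ‖↑(ψ_{U₀}(X) c) − ↑((Dψ_{U₀}(0) X) c)‖ ≤ 4550400·ℓ²·(2d)·Σ_b ‖X b‖²`** for EVERY `X`: volume-free, no `L^k`,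
  no smallness of `X` — the one-step smooth-purse count.

HONEST SCOPE.  Counting and the triangle inequality over a landed brick; the constant is (β-3)'s crude numeric times `2d` (the `1∕L` pair-weight gain of this seat's word census,
HOME `ym3-torus-px20/g23/compute/`, is GUIDANCE and NOT used); nothing of Bałaban's renormalisation analysis is asserted or proved beyond the printed (123) already in the tree;
the k-step assembly of AVG₂♭-ax_q (propagation of the one-step brackets through `DMq`, Q7 ✓p827759; the tower budget of the stage chords), AVG₂♭-ax_q itself, «MULT♭-ax»∕«CRIT-ax»,
(D-ax), GAP♯∘ (`stub_uniformFibreGapOrbit`; registry `Lines/semiclassical_s2beta.lean` UNTOUCHED), the five REGISTERED stubs, S2β, crux 20520, 19936, 19200 and `YM3TorusSU2`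
are NOT proved; no summit statement is proved by a helper; rung R3 = SU(2) YM₃ on T³ at fixed lattice data — NOT d = 4, NOT infinite volume, NOT a mass gap, NOT Clay; the
Yang–Mills mass gap is NOT proved.  Axioms standard.

References: T. Bałaban, CMP **98** (1985) 17–51 [Balaban1985Averaging] (Prop. 3 (121)–(123) p.36, locality p.19); CMP **109** (1987) 249–301 [Balaban1987RG1] ((0.4) p.253).
-/

set_option autoImplicit false

noncomputable section

open scoped Matrix.Norms.L2Operator Topology
open Filter Set Function Metric

namespace Summit.QuantumFields.YangMills.Theorems.FluctuationComparisonRegPrIntLS2BetaSecondOrderTwoBlockCount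

open Literature.MathematicalPhysics.QuantumFieldTheory.Balaban1983to89
open Literature.MathematicalPhysics.QuantumFieldTheory.Balaban1983to89.HaarExponentialChart
open Literature.MathematicalPhysics.QuantumFieldTheory.Balaban1983to89.HaarExponentialChart.IsChartRep
open Literature.MathematicalPhysics.QuantumFieldTheory.Balaban1983to89.BlockAveraging (avgFun loopHol)
open Literature.MathematicalPhysics.QuantumFieldTheory.Balaban1983to89.ExpMeanLog (expMeanLogSU)
open Literature.MathematicalPhysics.QuantumFieldTheory.Balaban1983to89.Node00
open Summit.QuantumFields.YangMills.BalabanUVNodes.N09ChartReadAveragingSmooth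
open Summit.QuantumFields.YangMills.Theorems.FluctuationComparisonRegPrIntLS2BetaChartReadSecondOrder (norm_chartRead_sub_fderiv_le_local_SU2)

variable {P : Params} {j : ℕ}

/-! ## §1 The incidence count: every fine block is `c₋` for `d` coarse bonds and `c₊` for `d` coarse bonds -/

section Count

/-- **THE TWO-BLOCK INCIDENCE COUNT**: a coarse site `y` is the initial point of exactly the `d` bonds `⟨y, μ⟩` and the final point of exactly the `d` bonds `⟨y − e_μ, μ⟩`;
hence `#{c ∣ y = c₋ ∨ y = c₊} ≤ 2d`. [folklore] -/
theorem card_filter_src_or_tgt_le (y : Site P (j + 1)) :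
    (Finset.univ.filter (fun c : PBond P (j + 1) => y = c.src ∨ y = c.tgt)).card ≤ 2 * P.d := by
  classical
  have hsub : Finset.univ.filter (fun c : PBond P (j + 1) => y = c.src ∨ y = c.tgt) ⊆
      Finset.univ.image (fun μ : Fin P.d => (⟨y, μ⟩ : PBond P (j + 1))) ∪
        Finset.univ.image (fun μ : Fin P.d => (⟨y.unshift μ, μ⟩ : PBond P (j + 1))) := by
    intro c hc
    rw [Finset.mem_filter] at hc
    rw [Finset.mem_union, Finset.mem_image, Finset.mem_image]
    obtain ⟨s, μ⟩ := c
    rcases hc.2 with h | h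
    · exact Or.inl ⟨μ, Finset.mem_univ _, by rw [h]⟩
    · refine Or.inr ⟨μ, Finset.mem_univ _, ?_⟩
      have hs : y.unshift μ = s := by
        rw [h]; exact T4ReflectionCone.shift_unshift s μ
      rw [hs]
  calc (Finset.univ.filter (fun c : PBond P (j + 1) => y = c.src ∨ y = c.tgt)).card
      ≤ (Finset.univ.image (fun μ : Fin P.d => (⟨y, μ⟩ : PBond P (j + 1))) ∪
          Finset.univ.image (fun μ : Fin P.d => (⟨y.unshift μ, μ⟩ : PBond P (j + 1)))).card := Finset.card_le_card hsub
    _ ≤ (Finset.univ.image (fun μ : Fin P.d => (⟨y, μ⟩ : PBond P (j + 1)))).card +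
          (Finset.univ.image (fun μ : Fin P.d => (⟨y.unshift μ, μ⟩ : PBond P (j + 1)))).card := Finset.card_union_le _ _
    _ ≤ P.d + P.d := add_le_add (Finset.card_image_le.trans (by simp)) (Finset.card_image_le.trans (by simp))
    _ = 2 * P.d := by ring

/-- ★ **FUBINI + THE COUNT**: for a non-negative function `g` on fine bonds, summing `g` over the two blocks of every coarse bond counts each fine bond at most `2d` times:
`Σ_c Σ_{b : blockOf b₋ ∈ {c₋, c₊}} g b ≤ 2d·Σ_b g b`. [folklore] -/
theorem sum_sum_twoBlock_le (g : PBond P j → ℝ) (hg : ∀ b, 0 ≤ g b) :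
    ∑ c : PBond P (j + 1), ∑ b ∈ Finset.univ.filter (fun b : PBond P j => blockOf b.src = c.src ∨ blockOf b.src = c.tgt), g b ≤
      2 * (P.d : ℝ) * ∑ b : PBond P j, g b := by
  classical
  -- write the inner sum as a sum over all fine bonds with an indicator, then swap
  have hswap : ∑ c : PBond P (j + 1), ∑ b ∈ Finset.univ.filter (fun b : PBond P j => blockOf b.src = c.src ∨ blockOf b.src = c.tgt), g b =
      ∑ b : PBond P j, g b * ((Finset.univ.filter (fun c : PBond P (j + 1) => blockOf b.src = c.src ∨ blockOf b.src = c.tgt)).card : ℝ) := by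
    simp_rw [Finset.sum_filter]
    rw [Finset.sum_comm]
    refine Finset.sum_congr rfl fun b _ => ?_
    rw [← Finset.sum_filter, Finset.sum_const, nsmul_eq_mul, mul_comm]
  rw [hswap, Finset.mul_sum]
  refine Finset.sum_le_sum fun b _ => ?_
  have hc : ((Finset.univ.filter (fun c : PBond P (j + 1) => blockOf b.src = c.src ∨ blockOf b.src = c.tgt)).card : ℝ) ≤ 2 * (P.d : ℝ) := by
    exact_mod_cast card_filter_src_or_tgt_le (blockOf b.src)
  calc g b * ((Finset.univ.filter (fun c : PBond P (j + 1) => blockOf b.src = c.src ∨ blockOf b.src = c.tgt)).card : ℝ)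
      ≤ g b * (2 * (P.d : ℝ)) := mul_le_mul_of_nonneg_left hc (hg b)
    _ = 2 * (P.d : ℝ) * g b := by ring

end Count

/-! ## §2 The sup norm of a truncated field against the `ℓ²` sum over the kept bonds -/

section Truncate

variable {E : Type*} [NormedAddCommGroup E]

/-- `‖X·𝟙_S‖ ≤ √(Σ_{b ∈ S} ‖X b‖²)` for the sup norm of a finite product (each kept component is one term of the sum). [folklore] -/
theorem norm_truncate_le_sqrt_sum (X : PBond P j → E) (S : PBond P j → Prop) [DecidablePred S] :
    ‖(fun b : PBond P j => if S b then X b else 0)‖ ≤ √(∑ b ∈ Finset.univ.filter S, ‖X b‖ ^ 2) := by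
  classical
  refine (pi_norm_le_iff_of_nonneg (Real.sqrt_nonneg _)).2 fun b => ?_
  by_cases hb : S b
  · simp only [hb, if_true]
    rw [← Real.sqrt_sq (norm_nonneg (X b))]
    refine Real.sqrt_le_sqrt ?_
    have hmem : b ∈ Finset.univ.filter S := by rw [Finset.mem_filter]; exact ⟨Finset.mem_univ _, hb⟩
    exact Finset.single_le_sum (f := fun b => ‖X b‖ ^ 2) (fun b _ => sq_nonneg _) hmem
  · simp only [hb, if_false, norm_zero]
    exact Real.sqrt_nonneg _

/-- ★ `‖X·𝟙_S‖² ≤ Σ_{b ∈ S} ‖X b‖²`. [folklore] -/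
theorem norm_truncate_sq_le_sum (X : PBond P j → E) (S : PBond P j → Prop) [DecidablePred S] :
    ‖(fun b : PBond P j => if S b then X b else 0)‖ ^ 2 ≤ ∑ b ∈ Finset.univ.filter S, ‖X b‖ ^ 2 := by
  have h := norm_truncate_le_sqrt_sum X S
  have h0 : 0 ≤ ∑ b ∈ Finset.univ.filter S, ‖X b‖ ^ 2 := Finset.sum_nonneg fun _ _ => sq_nonneg _
  calc ‖(fun b : PBond P j => if S b then X b else 0)‖ ^ 2 ≤ (√(∑ b ∈ Finset.univ.filter S, ‖X b‖ ^ 2)) ^ 2 :=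
        pow_le_pow_left₀ (norm_nonneg _) h 2
    _ = ∑ b ∈ Finset.univ.filter S, ‖X b‖ ^ 2 := Real.sq_sqrt h0

end Truncate

/-! ## §3 The `ℓ¹` sum over coarse bonds -/

section SU2

/-- ★★★ **THE TWO-BLOCK `ℓ¹` COUNT OF THE ORDER-2 BRICK** (`SU(2)`, loop guard `α ≤ 1∕12`, `j + 1 ≤ m + K`): for EVERY chart direction `X`,
`Σ_c ‖↑(ψ_{U₀}(X) c) − ↑((Dψ_{U₀}(0) X) c)‖ ≤ 4550400·((d+2)L)²·(2d)·Σ_b ‖X b‖²` — `ℓ¹` over coarse bonds against `ℓ²` over fine bonds, no volume factor, no smallness of `X`.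
[cite: Balaban1985Averaging, Prop. 3 (123) p.36] -/
theorem sum_norm_chartRead_sub_fderiv_le_SU2 (hj : j + 1 ≤ P.m + P.K) (U₀ : GaugeField P j (SU 2)) {α : ℝ}
    (hα : ∀ c i, dist1 (loopHol U₀ c i) ≤ α) (hα12 : α ≤ 1 / 12)
    (X : PBond P j → (specialUnitaryLogChart (Fin 2)).lie) :
    ∑ c : PBond P (j + 1), ‖(((isChartRep_specialUnitaryGroup (n := Fin 2)).logChart (avgFun (expMeanLogSU (n := Fin 2)) (fun b => (isChartRep_specialUnitaryGroup (n := Fin 2)).expChart (X b) * U₀ b) c * (avgFun (expMeanLogSU (n := Fin 2)) U₀ c)⁻¹) : (specialUnitaryLogChart (Fin 2)).lie) : Matrix (Fin 2) (Fin 2) ℂ) - ((fderiv ℝ (fun (A : PBond P j → (specialUnitaryLogChart (Fin 2)).lie) (c : PBond P (j + 1)) => (isChartRep_specialUnitaryGroup (n := Fin 2)).logChart (avgFun (expMeanLogSU (n := Fin 2)) (fun b => (isChartRep_specialUnitaryGroup (n := Fin 2)).expChart (A b) * U₀ b) c * (avgFun (expMeanLogSU (n := Fin 2)) U₀ c)⁻¹))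 0 X c : (specialUnitaryLogChart (Fin 2)).lie) : Matrix (Fin 2) (Fin 2) ℂ)‖ ≤
      4550400 * (((P.d + 2) * P.L : ℕ) : ℝ) ^ 2 * (2 * (P.d : ℝ)) * ∑ b : PBond P j, ‖X b‖ ^ 2 := by
  classical
  have hC : 0 ≤ 4550400 * (((P.d + 2) * P.L : ℕ) : ℝ) ^ 2 := by positivity
  calc _ ≤ ∑ c : PBond P (j + 1), 4550400 * (((P.d + 2) * P.L : ℕ) : ℝ) ^ 2 *
            ∑ b ∈ Finset.univ.filter (fun b : PBond P j => blockOf b.src = c.src ∨ blockOf b.src = c.tgt), ‖X b‖ ^ 2 :=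
        Finset.sum_le_sum fun c _ => (norm_chartRead_sub_fderiv_le_local_SU2 hj U₀ hα hα12 X c).trans
          (mul_le_mul_of_nonneg_left (norm_truncate_sq_le_sum X (fun b : PBond P j => blockOf b.src = c.src ∨ blockOf b.src = c.tgt)) hC)
    _ = 4550400 * (((P.d + 2) * P.L : ℕ) : ℝ) ^ 2 *
          ∑ c : PBond P (j + 1), ∑ b ∈ Finset.univ.filter (fun b : PBond P j => blockOf b.src = c.src ∨ blockOf b.src = c.tgt), ‖X b‖ ^ 2 := by
        rw [Finset.mul_sum]
    _ ≤ 4550400 * (((P.d + 2) * P.L : ℕ) : ℝ) ^ 2 * (2 * (P.d : ℝ) * ∑ b : PBond P j, ‖X b‖ ^ 2) :=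
        mul_le_mul_of_nonneg_left (sum_sum_twoBlock_le (fun b => ‖X b‖ ^ 2) fun b => sq_nonneg _) hC
    _ = 4550400 * (((P.d + 2) * P.L : ℕ) : ℝ) ^ 2 * (2 * (P.d : ℝ)) * ∑ b : PBond P j, ‖X b‖ ^ 2 := by ring

end SU2

end Summit.QuantumFields.YangMills.Theorems.FluctuationComparisonRegPrIntLS2BetaSecondOrderTwoBlockCount

end
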